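import Literature.MathematicalPhysics.QuantumFieldTheory.QuasiLocalGaugePerturbation
import Literature.Analysis.Complex.MontelSCV

/-!
# Line `Sketch` for the crux `RobustYangMillsRG` (stmt-QuantumFields-14958) — stub
# `stub_montelClosedFormat` (card `block-lattice-compactness`, normal-family half)

Crux: `Summit.QuantumFields.QCD.Theses.NestedDissectionSea.RobustYangMillsRG` (shared verbatim with
`HeavyThresholdYMBridge`), item stmt-QuantumFields-14958; skeleton `Cruxes/RobustYangMillsRG/Lines/Sketch.lean`
(lead `prover-line-stmt-QuantumFields-14958-0`).  The registered stub `stub_montelClosedFormat`, closed: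
the analytic weighted-norm bound `HasAnalyticNormLE ρ D κ B` of quasi-local gauge perturbations on a
fixed block torus (Bałaban's format: every polymer activity is the restriction of a function
holomorphic on the open domain `D X`, bounded there by `M X`, with `∑_{X ∋ y} M X e^{κ|X|} ≤ B`) is
closed under pointwise limits of the activities on real configurations, provided every `D X` is open
and nonempty.

Proof: Montel's theorem in several complex variables (tree
`Literature.Analysis.Complex.SCV.exists_strictMono_tendstoLocallyUniformlyOn_of_norm_le`) applied ONCE,
on the product domain `∏_X D X ⊆ (P → ComplexGaugeConfig)` over the finitely many nonempty polymers
`P`, to the maps `z' ↦ ((X ↦ F_{n,X}(z'_X)), (X ↦ M_{n,X}))` (the bounds ride along as constants), which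
yields one common subsequence along which all extensions converge locally uniformly (to holomorphic
limits, read off through the affine slices `z ↦ update z₀ X z`) and all bounds converge; the real-point
identities and the bounds pass to the limit, and so do the finite weighted sums.  The empty polymer
is treated by hand: its activity depends on no link, hence is constant, and extends constantly.
-/

set_option autoImplicit false

noncomputable section

open scoped Topology
open scoped Matrix.Norms.Frobenius
open Filter
open Literature.MathematicalPhysics.QuantumLattice Literature.MathematicalPhysics.QuantumFieldTheory

namespace Summit.QuantumFields.QCD.Cruxes.RobustYangMillsRG.Sketch

/-- **Montel closure of the analytic format** (corrected: nonempty domains): on a fixed block torus,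
if perturbations `Wseq n` all satisfy `HasAnalyticNormLE ρ D κ B` on OPEN, NONEMPTY domains `D X` and
their activities converge pointwise on real configurations to those of `W`, then `W` satisfies the
same bound (Montel in several variables on each `D X`, tree
`Literature.Analysis.Complex.SCV.exists_strictMono_tendstoLocallyUniformlyOn_of_norm_le`, a common
subsequence over the finitely many polymers, bounds passing to the limit on the finite weighted sums;
`X = ∅` by hand: its activity is constant). -/
def MontelClosedFormat : Prop :=
  ∀ (d L N : ℕ) [NeZero L] (G : Type) [Group G] [MeasurableSpace G] (b : ℕ)
    (ρ : G →* Matrix (Fin N) (Fin N) ℂ)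
    (D : Finset (Site d L) → Set (ComplexGaugeConfig d L N)) (κ B : ℝ),
    (∀ X, IsOpen (D X)) → (∀ X, (D X).Nonempty) →
    ∀ (Wseq : ℕ → QuasiLocalGaugePerturbation d L G b) (W : QuasiLocalGaugePerturbation d L G b),
      (∀ n, (Wseq n).HasAnalyticNormLE ρ D κ B) →
      (∀ X U, Tendsto (fun n => (Wseq n).act X U) atTop (𝓝 (W.act X U))) →
        W.HasAnalyticNormLE ρ D κ B

/-- **Common Montel subsequence for finitely many families with convergent bounds.**  Let `D i`,
`i : ι` finite, be open nonempty subsets of a finite-dimensional complex normed space `E`, and let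
`F n i` be holomorphic on `D i` with `‖F n i z‖ ≤ Mseq n i ≤ C` there.  Then along ONE strictly
increasing `φ` every `F (φ n) i` converges pointwise on `D i` to a function holomorphic on `D i` and
every `Mseq (φ n) i` converges.  (Montel in several variables on the product domain `∏ᵢ D i` for the
maps `z' ↦ ((i ↦ F n i (z' i)), (i ↦ Mseq n i))`.) -/
private theorem montel_common_subseq {E : Type*} [NormedAddCommGroup E] [NormedSpace ℂ E]
    [FiniteDimensional ℂ E] {ι : Type*} [Finite ι] {D : ι → Set E}
    (hDo : ∀ i, IsOpen (D i)) (hDn : ∀ i, (D i).Nonempty)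
    {F : ℕ → ι → E → ℂ} {Mseq : ℕ → ι → ℝ} {C : ℝ}
    (hF : ∀ n i, DifferentiableOn ℂ (F n i) (D i))
    (hFM : ∀ n i, ∀ z ∈ D i, ‖F n i z‖ ≤ Mseq n i) (hMC : ∀ n i, Mseq n i ≤ C) :
    ∃ φ : ℕ → ℕ, StrictMono φ ∧ ∃ (Flim : ι → E → ℂ) (Mlim : ι → ℝ),
      (∀ i, DifferentiableOn ℂ (Flim i) (D i)) ∧
      (∀ i, ∀ z ∈ D i, Tendsto (fun n => F (φ n) i z) atTop (𝓝 (Flim i z))) ∧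
      (∀ i, Tendsto (fun n => Mseq (φ n) i) atTop (𝓝 (Mlim i))) := by
  classical
  haveI : Fintype ι := Fintype.ofFinite ι
  -- a base point of the product domain
  have hDn' : ∀ i, ∃ z, z ∈ D i := hDn
  choose z₀ hz₀ using hDn'
  have hU'o : IsOpen (Set.univ.pi D : Set (ι → E)) := isOpen_set_pi Set.finite_univ fun i _ => hDo i
  have hz₀U : z₀ ∈ Set.univ.pi D := Set.mem_univ_pi.2 hz₀
  -- the maps to which Montel's theorem is applied
  obtain ⟨f, hf⟩ : ∃ f : ℕ → (ι → E) → (ι → ℂ) × (ι → ℂ),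
      ∀ n z', f n z' = (fun i => F n i (z' i), fun i => (Mseq n i : ℂ)) := ⟨_, fun _ _ => rfl⟩
  have hfd : ∀ n, DifferentiableOn ℂ (f n) (Set.univ.pi D) := by
    intro n
    have : f n = fun z' => (fun i => F n i (z' i), fun i => (Mseq n i : ℂ)) := funext (hf n)
    rw [this]
    refine DifferentiableOn.prodMk (differentiableOn_pi.2 fun i => ?_) (differentiableOn_const _)
    exact (hF n i).comp (differentiableOn_apply i _) fun z' hz' => Set.mem_univ_pi.1 hz' i
  have hM0 : ∀ n i, 0 ≤ Mseq n i := fun n i => (norm_nonneg _).trans (hFM n i (z₀ i) (hz₀ i))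
  have hfb : ∀ n, ∀ z' ∈ Set.univ.pi D, ‖f n z'‖ ≤ max C 0 := by
    intro n z' hz'
    rw [hf n, norm_prod_le_iff]
    refine ⟨(pi_norm_le_iff_of_nonneg (le_max_right _ _)).2 fun i => ?_,
      (pi_norm_le_iff_of_nonneg (le_max_right _ _)).2 fun i => ?_⟩
    · exact (hFM n i _ (Set.mem_univ_pi.1 hz' i)).trans ((hMC n i).trans (le_max_left _ _))
    · show ‖(Mseq n i : ℂ)‖ ≤ max C 0
      rw [Complex.norm_real, Real.norm_of_nonneg (hM0 n i)]
      exact (hMC n i).trans (le_max_left _ _)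
  obtain ⟨g, φ, hφ, hg, hlim⟩ :=
    Literature.Analysis.Complex.SCV.exists_strictMono_tendstoLocallyUniformlyOn_of_norm_le hU'o hfd hfb
  -- the affine slices `z ↦ update z₀ i z` map `D i` into the product domain
  have hemb_mem : ∀ i, ∀ z ∈ D i, Function.update z₀ i z ∈ Set.univ.pi D := by
    intro i z hz
    refine Set.mem_univ_pi.2 fun j => ?_
    rcases eq_or_ne j i with rfl | hji
    · rwa [Function.update_self]
    · rw [Function.update_of_ne hji]
      exact hz₀ j
  have hemb_diff : ∀ i, Differentiable ℂ (Function.update z₀ i : E → ι → E) := fun i z =>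
    (hasFDerivAt_update (𝕜 := ℂ) z₀ z).differentiableAt
  refine ⟨φ, hφ, fun i z => (g (Function.update z₀ i z)).1 i, fun i => ((g z₀).2 i).re, ?_, ?_, ?_⟩
  · intro i
    exact differentiableOn_pi.1 ((hg.comp (hemb_diff i).differentiableOn (hemb_mem i)).fst) i
  · intro i z hz
    have h1 : Tendsto (fun n => f (φ n) (Function.update z₀ i z)) atTop
        (𝓝 (g (Function.update z₀ i z))) := hlim.tendsto_at (hemb_mem i z hz)
    have h2 := tendsto_pi_nhds.1 h1.fst_nhds i
    simpa [hf] using h2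
  · intro i
    have h1 : Tendsto (fun n => f (φ n) z₀) atTop (𝓝 (g z₀)) := hlim.tendsto_at hz₀U
    have h2 := (Complex.continuous_re.tendsto _).comp (tendsto_pi_nhds.1 h1.snd_nhds i)
    simpa [hf, Function.comp_def] using h2

/-- **stub_montelClosedFormat** — the registered stub, closed (size M: tree Montel SCV on the product
of the domains of the nonempty polymers + finite bookkeeping; the empty polymer by hand). -/
theorem stub_montelClosedFormat : MontelClosedFormat := by
  intro d L N _ G _ _ b ρ D κ B hDo hDn Wseq W hW hlim
  classical
  -- Step 1: the bounds `Mseq n` and the holomorphic extensions `Fseq n X`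
  have hW' : ∀ n, ∃ M : Finset (Site d L) → ℝ, (Wseq n).IsAnalyticOn ρ D M ∧
      ∀ y ∈ blockCorners (d := d) (L := L) b,
        ∑ X ∈ polymersThrough b y, M X * Real.exp (κ * X.card) ≤ B := hW
  choose Mseq hMseq using hW'
  have hA : ∀ n, ∀ X ∈ polymers (d := d) (L := L) b, ∃ F : ComplexGaugeConfig d L N → ℂ,
      DifferentiableOn ℂ F (D X) ∧
        (∀ U : GaugeConfig d L G, complexify ρ U ∈ D X → F (complexify ρ U) = (Wseq n).act X U) ∧
          ∀ Z ∈ D X, ‖F Z‖ ≤ Mseq n X := fun n => (hMseq n).1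
  choose Fseq hFd hFeq hFle using hA
  -- Step 2: nonnegativity of the bounds (the domains are nonempty)
  have hM0 : ∀ n, ∀ X ∈ polymers (d := d) (L := L) b, 0 ≤ Mseq n X := fun n X hX =>
    (norm_nonneg _).trans (hFle n X hX _ (hDn X).some_mem)
  -- Step 3: a bound uniform in `n` for nonempty polymers (single term ≤ weighted sum ≤ B)
  have hMB : ∀ n, ∀ X ∈ polymers (d := d) (L := L) b, X.Nonempty →
      Mseq n X ≤ B * Real.exp (-(κ * X.card)) := by
    intro n X hX hne
    obtain ⟨y, hy⟩ := hne
    have hyc : y ∈ blockCorners b := mem_polymers_iff.1 hX hy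
    have h1 : Mseq n X * Real.exp (κ * X.card) ≤ B :=
      (Finset.single_le_sum (f := fun X' => Mseq n X' * Real.exp (κ * X'.card))
        (fun X' hX' => mul_nonneg (hM0 n X' (mem_polymersThrough_iff.1 hX').1) (Real.exp_pos _).le)
        (mem_polymersThrough_iff.2 ⟨hX, hy⟩)).trans ((hMseq n).2 y hyc)
    calc Mseq n X = Mseq n X * Real.exp (κ * X.card) * Real.exp (-(κ * X.card)) := by
          rw [mul_assoc, ← Real.exp_add, add_neg_cancel, Real.exp_zero, mul_one]
      _ ≤ B * Real.exp (-(κ * X.card)) := mul_le_mul_of_nonneg_right h1 (Real.exp_pos _).le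
  have hMC : ∀ n, ∀ X ∈ polymers (d := d) (L := L) b, X.Nonempty →
      Mseq n X ≤ ∑ Y ∈ polymers (d := d) (L := L) b, |B| * Real.exp (-(κ * Y.card)) := by
    intro n X hX hne
    refine (hMB n X hX hne).trans (le_trans ?_
      (Finset.single_le_sum (f := fun Y => |B| * Real.exp (-(κ * Y.card)))
        (fun Y _ => by positivity) hX))
    exact mul_le_mul_of_nonneg_right (le_abs_self B) (Real.exp_pos _).le
  -- Step 4: ONE Montel extraction over the finitely many nonempty polymers
  obtain ⟨φ, hφ, Flim, Mlim, hFlimD, hFlimT, hMlimT⟩ :=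
    montel_common_subseq
      (ι := {X : Finset (Site d L) // X ∈ polymers (d := d) (L := L) b ∧ X.Nonempty})
      (D := fun X => D X.1) (F := fun n X => Fseq n X.1 X.2.1) (Mseq := fun n X => Mseq n X.1)
      (fun X => hDo X.1) (fun X => hDn X.1) (fun n X => hFd n X.1 X.2.1)
      (fun n X => hFle n X.1 X.2.1) (fun n X => hMC n X.1 X.2.1 X.2.2)
  -- a reference real configuration (for the constant activity of the empty polymer)
  obtain ⟨U₀⟩ : Nonempty (GaugeConfig d L G) := ⟨fun _ => 1⟩
  -- Step 5: the limit bounds and the limit extensions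
  obtain ⟨M', hM'⟩ : ∃ M' : Finset (Site d L) → ℝ, ∀ X,
      M' X = if h : X ∈ polymers (d := d) (L := L) b ∧ X.Nonempty then Mlim ⟨X, h⟩
        else |W.act ∅ U₀| := ⟨_, fun _ => rfl⟩
  refine ⟨M', ?_, ?_⟩
  · intro X hX
    by_cases hne : X.Nonempty
    · have hXn : X ∈ polymers (d := d) (L := L) b ∧ X.Nonempty := ⟨hX, hne⟩
      have hT : ∀ z ∈ D X, Tendsto (fun n => Fseq (φ n) X hX z) atTop
          (𝓝 (Flim ⟨X, hXn⟩ z)) := fun z hz => hFlimT ⟨X, hXn⟩ z hz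
      refine ⟨Flim ⟨X, hXn⟩, hFlimD ⟨X, hXn⟩, fun U hU => ?_, fun Z hZ => ?_⟩
      · -- the real-point identity passes to the limit
        have h2 : Tendsto (fun n => Fseq (φ n) X hX (complexify ρ U)) atTop
            (𝓝 ((W.act X U : ℝ) : ℂ)) := by
          have h3 := (Complex.continuous_ofReal.tendsto _).comp ((hlim X U).comp hφ.tendsto_atTop)
          exact h3.congr fun n => (hFeq (φ n) X hX U hU).symm
        exact tendsto_nhds_unique (hT _ hU) h2
      · -- the bound passes to the limit
        rw [hM', dif_pos hXn]
        exact le_of_tendsto_of_tendsto' (hT Z hZ).norm (hMlimT ⟨X, hXn⟩)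
          fun n => hFle (φ n) X hX Z hZ
    · -- the empty polymer: a constant activity, extended constantly
      obtain rfl : X = ∅ := Finset.not_nonempty_iff_eq_empty.1 hne
      have hXn : ¬ ((∅ : Finset (Site d L)) ∈ polymers (d := d) (L := L) b ∧
          (∅ : Finset (Site d L)).Nonempty) := fun h => hne h.2
      refine ⟨fun _ => ((W.act ∅ U₀ : ℝ) : ℂ), differentiableOn_const _, fun U _ => ?_,
        fun Z _ => ?_⟩
      · exact congrArg (fun r : ℝ => (r : ℂ))
          (W.dependsOn' ∅ fun e he => by simp [mem_polymerEdges_iff] at he)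
      · rw [hM', dif_neg hXn, Complex.norm_real, Real.norm_eq_abs]
  · -- Step 6: the finite weighted sums pass to the limit
    intro y hy
    have hT : ∀ X ∈ polymersThrough b y,
        Tendsto (fun n => Mseq (φ n) X * Real.exp (κ * X.card)) atTop
          (𝓝 (M' X * Real.exp (κ * X.card))) := by
      intro X hX
      have h : X ∈ polymers (d := d) (L := L) b ∧ X.Nonempty :=
        ⟨(mem_polymersThrough_iff.1 hX).1, y, (mem_polymersThrough_iff.1 hX).2⟩
      rw [hM', dif_pos h]
      exact (hMlimT ⟨X, h⟩).mul_const _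
    exact le_of_tendsto' (tendsto_finsetSum _ hT) fun n => (hMseq (φ n)).2 y hy

end Summit.QuantumFields.QCD.Cruxes.RobustYangMillsRG.Sketch

end
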